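import Literature.AlgebraicGeometry.AbelianSchemes.AbelianSchemeFiniteSubgroupTorsion
import Literature.AlgebraicGeometry.AbelianSchemes.AbelianSchemePolarization
import Literature.AlgebraicGeometry.GroupSchemes.GroupSchemeKernel
import Mathlib.AlgebraicGeometry.Morphisms.FlatRank
import HarnessLib

/-!
# The order of a finite subgroup scheme is the rank of its structure morphism; fibre orders of a finite flat closed subgroup
# subscheme are the ranks of `Z → S` (Mathlib `Scheme.Hom.finrank`) — sketch (O9c)

Layer `Literature/AlgebraicGeometry/AbelianSchemes` (§1 in `Literature.AlgebraicGeometry.Motives.AbelianVariety.FiniteSubgroupSubscheme`,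
§§2–3 in `Literature.AlgebraicGeometry.AbelianSchemes.AbelianSchemeOver`).  THEOREMS ONLY (no definition, no named fact, no instance, no
notation, no `sorry`).  Cell `hodgecm-mathlib` (D-0151), sub-desk P6b census (O9) brick **(O9c)**: the DICTIONARY between the tree's ORDER
`dim_K Γ(Z, 𝒪)` of a finite subgroup scheme over a field (★ `FiniteSubgroupSubscheme.order`, [GortzWedhorn2023] §(27.2)) and Mathlib's RANK of
a finite flat morphism `Scheme.Hom.finrank` ([StacksProject] 02KA; `Mathlib/AlgebraicGeometry/Morphisms/FlatRank`), so that the fibre orders the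
torsion brick ★ (T3′) `pow_eq_one_of_forall_order_dvd` asks for are READ OFF the rank of `Z → S`, and — for `Z = Ker λ` of a finite flat
polarisation of rank `d²` ([MumfordFogartyKirwan1994] Def. 7.2 (ii)) — off the rank of `λ` (base change, Mathlib `Scheme.Hom.finrank_of_isPullback`).
* §1 `FiniteSubgroupSubscheme.order_eq_finrank` — `D.order = (Z → Spec K).finrank x` (any `x`; `Z` is affine, `Z → Spec K ≅ Spec Γ(Z, 𝒪) → Spec K`,
  Mathlib `finrank_SpecMap_eq_finrank` + `Module.rankAtStalk_eq_finrank_of_free`).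
* §2 `order_finiteSubgroupSubschemeFibre_eq_finrank` — for `Z → Spec R` finite FLAT, the order of the fibre `Z_t ⊆ A_t` at a field point
  `t : Spec K → Spec R` is `(Z → Spec R).finrank (t x)` (Mathlib `finrank_pullback_snd`).
* §3 `Polarization.finrank_ker_hom_eq` — for a finite flat polarisation `λ`, `(Ker λ → S).finrank s = λ.finrank (ε_Â s)` (★ `GroupSchemeKernel.isPullback_kerι_left`,
  Mathlib `finrank_of_isPullback`); with §2: the fibre orders of `Ker λ` are the ranks of `λ`.
HC_CM is proved only modulo the printed citations until rung 0 closes; nothing here is about HC.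

## References
* [GortzWedhorn2023] U. Görtz, T. Wedhorn, *Algebraic Geometry II* (2023), §(27.2) (p. 606), Prop. 27.86 (p. 633).
* [GortzWedhorn2020] U. Görtz, T. Wedhorn, *Algebraic Geometry I*, 2nd ed. (2020), Prop. 12.19 and the definition after it (p. 332), Def. 4.45 (p. 117).
* [StacksProject] The Stacks Project, Tag 02KA.
* [MumfordFogartyKirwan1994] D. Mumford, J. Fogarty, F. Kirwan, *GIT*, 3rd ed. (1994), Ch. 7 §2 Def. 7.2 (p. 129).
-/

set_option autoImplicit false

noncomputable section

set_option backward.isDefEq.respectTransparency false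

open CategoryTheory CategoryTheory.Limits AlgebraicGeometry MonoidalCategory CartesianMonoidalCategory

open scoped MonObj CategoryTheory.Obj

/-! ## §1 The order of a finite subgroup scheme over a field is the rank of its structure morphism -/

namespace Literature.AlgebraicGeometry.Motives.AbelianVariety.FiniteSubgroupSubscheme

universe u

variable {K : Type u} [Field K] {A : AbelianVariety K} (D : FiniteSubgroupSubscheme A)

/-- **`dim_K Γ(Z, 𝒪) = rk (Z → Spec K)`**: the order of a finite subgroup scheme over a field is Mathlib's rank of the (finite, flat)
structure morphism at the point of `Spec K`. [cite: GortzWedhorn2023, §(27.2) (p. 606)] [cite: StacksProject, Tag 02KA] -/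
theorem order_eq_finrank [Flat D.Z.hom] (x : Spec (.of K)) : D.order = D.Z.hom.finrank x := by
  haveI := D.isFinite
  haveI : IsAffine D.Z.left := D.isAffine_left
  -- `Z → Spec K` is `Z ≅ Spec Γ(Z, 𝒪) → Spec K` along `ψ = algebraMapΓ = ΓSpecIso⁻¹ ≫ appTop`
  have hfac' : D.Z.left.isoSpec.inv ≫ D.Z.hom = Spec.map (algebraMapΓ D.Z.hom) := by
    rw [← Scheme.isoSpec_inv_naturality, Scheme.isoSpec_Spec_inv, ← Spec.map_comp]
  have hfac : D.Z.hom = D.Z.left.isoSpec.hom ≫ Spec.map (algebraMapΓ D.Z.hom) := by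
    rw [← hfac', Iso.hom_inv_id_assoc]
  -- `ψ` is finite and flat
  have hψfin : (algebraMapΓ D.Z.hom).hom.Finite := by
    have h1 : D.Z.hom.appTop.hom.Finite := D.Z.hom.finite_appTop
    have h2 : (Scheme.ΓSpecIso (.of K)).inv.hom.Finite :=
      RingHom.Finite.of_surjective _ fun y ↦ ⟨(Scheme.ΓSpecIso (.of K)).hom.hom y, by
        rw [← CommRingCat.comp_apply, Iso.hom_inv_id, CommRingCat.id_apply]⟩
    exact h1.comp h2
  have hψflat : (algebraMapΓ D.Z.hom).hom.Flat := by
    change (algebraMap K D.Alg).Flat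
    rw [RingHom.Flat]
    convert (inferInstance : Module.Flat K D.Alg)
  haveI : IsFinite (Spec.map (algebraMapΓ D.Z.hom)) := (IsFinite.SpecMap_iff _).mpr hψfin
  haveI : Flat (Spec.map (algebraMapΓ D.Z.hom)) := Flat.SpecMap_iff.mpr hψflat
  rw [hfac, Scheme.Hom.finrank_comp_left_of_isIso, Scheme.Hom.finrank_SpecMap_eq_finrank hψfin hψflat]
  -- the rank of the free `K`-module `Γ(Z, 𝒪)` at the (unique) prime of `K`
  change Module.finrank K D.Alg = (algebraMap K D.Alg).finrank x
  rw [RingHom.finrank_algebraMap, Module.rankAtStalk_eq_finrank_of_free]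
  rfl

end Literature.AlgebraicGeometry.Motives.AbelianVariety.FiniteSubgroupSubscheme

/-! ## §2 Fibre orders of a finite flat closed subgroup subscheme are the ranks of `Z → Spec R` -/

namespace Literature.AlgebraicGeometry.AbelianSchemes

open Literature.AlgebraicGeometry.Motives Literature.AlgebraicGeometry.Motives.AbelianVariety Literature.AlgebraicGeometry.Limits
  Literature.AlgebraicGeometry.GroupSchemes Literature.AlgebraicGeometry.GroupSchemes.GroupSchemeKernel

namespace AbelianSchemeOver

variable {R : Type} [CommRing R] (A : AbelianSchemeOver (Spec (.of R)))

variable {Z : Over (Spec (.of R))} (i : Z ⟶ A.X) [IsClosedImmersion i.left] [IsFinite Z.hom]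
  (he : ∃ e : 𝟙_ (Over (Spec (.of R))) ⟶ Z, e ≫ i = 1)
  (hm : ∃ m : Z ⊗ Z ⟶ Z, m ≫ i = (fst Z Z ≫ i) * (snd Z Z ≫ i))
  (hn : ∃ n : Z ⟶ Z, n ≫ i = i⁻¹)

/-- **The order of the fibre `Z_t ⊆ A_t` at a field point `t` is the rank of `Z → Spec R` at `t(x)`** (`Z → Spec R` finite and FLAT;
§1 + Mathlib `Scheme.Hom.finrank_pullback_snd`). [cite: GortzWedhorn2023, §(27.2) (p. 606)] [cite: StacksProject, Tag 02KA]
[cite: GortzWedhorn2020, Prop. 12.19 and the definition after it (p. 332)] -/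
theorem order_finiteSubgroupSubschemeFibre_eq_finrank [Flat Z.hom] {K : Type} [Field K] (t : Spec (.of K) ⟶ Spec (.of R))
    (x : Spec (.of K)) :
    (A.finiteSubgroupSubschemeFibre i he hm hn t).order = Z.hom.finrank (t x) := by
  haveI : Flat ((Over.pullback t).obj Z).hom := inferInstanceAs (Flat (pullback.snd Z.hom t))
  rw [(A.finiteSubgroupSubschemeFibre i he hm hn t).order_eq_finrank x]
  exact Scheme.Hom.finrank_pullback_snd Z.hom t x

/-- **Hence: if `Z → Spec R` has constant rank `N`, every fibre order is `N`** — the hypothesis of ★ (T3′) with `N ∣ N`.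
[cite: GortzWedhorn2023, §(27.2) (p. 606) and Prop. 27.86 (p. 633)] [cite: StacksProject, Tag 02KA] -/
theorem order_finiteSubgroupSubschemeFibre_eq_of_finrank_eq [Flat Z.hom] {N : ℕ} (hN : ∀ s : Spec (.of R), Z.hom.finrank s = N)
    {K : Type} [Field K] (t : Spec (.of K) ⟶ Spec (.of R)) :
    (A.finiteSubgroupSubschemeFibre i he hm hn t).order = N := by
  rw [A.order_finiteSubgroupSubschemeFibre_eq_finrank i he hm hn t (IsLocalRing.closedPoint K), hN]

end AbelianSchemeOver

/-! ## §3 The kernel of a finite flat polarisation: `rk (Ker λ → S) = rk λ ∘ ε_Â` -/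

namespace AbelianSchemeOver

universe u

variable {S : Scheme.{u}} (A : AbelianSchemeOver S) {D : A.DualPair} (pol : A.Polarization D)

/-- **The square `Ker λ → A`, `Ker λ → S`, `λ`, `ε_Â` is cartesian** (★ `GroupSchemeKernel.isPullback_kerι_left`, with the second projection
`Ker λ → 𝟙_S` identified with the structure morphism: Mathlib `Over.toUnit_left`). [cite: GortzWedhorn2020, Definition 4.45 (2) (p. 117)] -/
theorem Polarization.isPullback_kerι_left_hom :
    IsPullback (kerι pol.lam).left (ker pol.lam).hom pol.lam.left D.hat.unitSection := by
  have h := isPullback_kerι_left pol.lam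
  rw [toUnit_unique (pullback.snd pol.lam η[D.hat.X]) (toUnit _)] at h
  exact h

/-- **`(Ker λ → S).finrank s = λ.finrank (ε_Â s)`** for a finite flat polarisation (Mathlib `Scheme.Hom.finrank_of_isPullback` on the
cartesian square above). [cite: GortzWedhorn2020, Definition 4.45 (2) (p. 117)] [cite: MumfordFogartyKirwan1994, Ch. 7 §2 Definition 7.2 (p. 129)]
[cite: StacksProject, Tag 02KA] -/
theorem Polarization.finrank_ker_hom_eq [IsFinite pol.lam.left] [Flat pol.lam.left] (s : S) :
    (ker pol.lam).hom.finrank s = pol.lam.left.finrank (D.hat.unitSection s) :=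
  Scheme.Hom.finrank_of_isPullback _ _ _ _ (pol.isPullback_kerι_left_hom A) s

/-- **`Ker λ → S` is flat when `λ` is** (base change). [cite: GortzWedhorn2020, Definition 4.45 (2) (p. 117)] -/
theorem Polarization.flat_ker_hom [Flat pol.lam.left] : Flat (ker pol.lam).hom :=
  MorphismProperty.of_isPullback (P := @Flat) (pol.isPullback_kerι_left_hom A) inferInstance

/-- **If `λ` has constant rank `N` (e.g. `N = d²`, [MFK] Def. 7.2 (ii)), then `Ker λ → S` has constant rank `N`.**
[cite: MumfordFogartyKirwan1994, Ch. 7 §2 Definition 7.2 (p. 129)] -/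
theorem Polarization.finrank_ker_hom_eq_of_finrank_lam_eq [IsFinite pol.lam.left] [Flat pol.lam.left] {N : ℕ}
    (hdeg : ∀ y, pol.lam.left.finrank y = N) (s : S) : (ker pol.lam).hom.finrank s = N := by
  rw [pol.finrank_ker_hom_eq A s, hdeg]

end AbelianSchemeOver

end Literature.AlgebraicGeometry.AbelianSchemes

end
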